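import Summits.BirchSwinnertonDyer.BirchSwinnertonDyer.Theorems.GoldfeldAllTwistsTwoConverseTwinGenusDescentPartnerNegTwoExact
import Summits.BirchSwinnertonDyer.BirchSwinnertonDyer.Theorems.GoldfeldAllTwistsTwoConverseTwinGenusDescentRankZero
import Literature.NumberTheory.EllipticCurves.Pal2012.QuadraticTwistPeriodProofs
import Literature.NumberTheory.EllipticCurves.ComplexMultiplicationBurungaleFlachProofs
import Literature.NumberTheory.EllipticCurves.RegulatorProofs
import Literature.NumberTheory.QuadraticForms.PadicSquares
import HarnessLib

set_option linter.dupNamespace false -- `…BirchSwinnertonDyer.BirchSwinnertonDyer…` is the cell's namespace (D-0017)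
set_option autoImplicit false

/-!
# LINE B49 — the FIXED partner curves, XIII: the `3136⁺` partner `E₂ = [0, 42, 0, 448, 0] = 49a1^{(2)}` of family F3:
# `c₇ = 2` (`III`), `c₂ = 4` EXACTLY (`I₈*`), `Tam = 8`, the period law `Ω(E₂)·√8 = Ω(X₀(49))`, and «BSD(3136⁺) exact»
# by name: `L(E₂, 1) = r · Ω(E₂)`, `v₂(r) = 1` (bsd.S31 + Modularity)

Cell `bsd-goldfeld`, seat `bsd-goldfeld-s1p-c3` (prover, gen 12); planner g28 ruling (cxxxi) TIER 0 («the `A^{(2)} =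
[0,0,0,−140,−784]` partner package»; `A^{(2)} ≅ E₂ = (1/2, 4, 0, 0) • cm7^{(2)}` over `ℚ`, files III/IV). Support for item
`stmt-BirchSwinnertonDyer-19350` (twin `BSDTwoCMSplitRankOne`; serves 19140/20044 through LINE B49's family F3 = `49a1^{(−2ℓ)}`,
`ℓ ≡ 3 (mod 4)` prime, `(ℓ/7) = −1`, genus pair `(8, −ℓ)`, whose FIXED partner is the rank-ZERO curve `49a1^{(8)} ≅ 49a1^{(2)}`;
memo `HOME/GENUS-THEOREM-A-DOUBLEPRIME-SCOPING.md` §2 step (4)). Theses-free. HONEST FRAMING: kernel theorems about ONE explicit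
curve; §6 takes bsd.S31 (`bsdTriple_of_rank_le_one_of_conductor_lt`) and Modularity (`exists_isNewformOf`) as NAMED binders;
BSD is not proved by any of this. ALREADY IN THE TREE for `E₂` (files III/IV/V): `IsElliptic`, `IsGloballyMinimal`,
`N = 3136`, `rank = 0 ∧ Ш[2] = 0` unconditionally (`rank_eq_zero_and_sha_two_twoTorsionModel_two`), `#E₂(ℚ)_tors = 2`, and by
name `r_an = 0`, `#Ш` odd, LEAD (`analyticRank_shaFinite_odd_twoTorsionModel_two`). PROVED HERE:
* §1 at `7`: Step-2 certificate `⟨7, 0, 0, 0, 3, 3, 2⟩` ⇒ type `III`, `ord₇ Δ_min = 3`, **`c₇ = 2`**;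
* §2 at `2`: the model itself is an `Iₙ*` normal form for round `m = 3` (`2 ∥ a₂`, `a₄ = 2⁶·7`, `2¹⁸ ∥ Δ`) ⇒ **`I₈*`**;
* §3 **`c₂ = 4` EXACTLY** by a new device (rank `0`: no rational bad points as in file XII): `−7 ≡ 1 (mod 8)` is a square
  `s²` in `ℤ₂`, so `J = E₂ ⊗ ℤ₂` has FULL `2`-torsion over `ℚ₂` — `T₀ = (0,0)`, `T₁ = (s − 21, 0)`, `T₂ = T₁ + T₀ =
  (−s − 21, 0)` — with all coordinates in `𝔪 = 2ℤ₂` (`s` odd), i.e. outside `J₀(ℚ₂)`; index `2` would put the three in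
  one coset containing `0`, so `[J(ℚ₂) : J₀(ℚ₂)] = 4` (`LocalIndex.index_mem_of_normalForm_Istar_succ`) and `c₂ = 4`
  (`LocalIndex.localTamagawaNumber_eq_index_of_smul_eq_baseChange`; minimality at `2` = file III's Kraus test);
* §4 **`Tam(E₂) = 8`**; §5 PERIOD LAW **`Ω(E₂)·√8 = Ω(X₀(49))`** (Pal 2012 Thm 3.2, `d = 2 > 0`, `u = 1/2`: Pal's `ũ = 1` for
  the twist by the fundamental discriminant `8`);
* §6 **`L(E₂, 1) = r·Ω(E₂)`, `r ∈ ℚ_{>0}`, `v₂(r) = 1`** (`r = 2·#Ш`: `Reg = 1`, `#tors = 2`, `Tam = 8`, `#Ш` odd), and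
  `L(E₂,1)·√8 = r·Ω(X₀(49))` — the input «`√8·L(49a1^{(2)},1)/L(49a1,1) = 4ρ`, `ρ` odd/odd» of the memo's step (4).
Numerics (c3 gen 11, kit j274861, PARI/GP; evidence #27 on 19350): `c₂ = 4`, `c₇ = 2`, `#tors = 2`, `w = +1`, `r_an = 0`,
`L(E₂,1) = 1.36705781719`, `Ω(E₂) = 0.683528908594`, `L/Ω = 2.000000000`, `√8·L(E₂,1)/L(49a1,1) = 4.000000000`.
References: [Silverman1994] IV.9.4 Steps 1–4, 7, Table 4.1; [SilvermanAEC2009] VII.1, VII.6; [Serre1973] II.3.3 Thm 4;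
[Pal2012] Thm 3.2; [CreutzMiller2012]; [Miller2011LMS]; [CremonaAlgorithms1997] Table 1 (N = 3136).
-/

noncomputable section

open scoped Classical NumberField

open WeierstrassCurve IsDedekindDomain IsLocalRing Rat.HeightOneSpectrum
  Literature.NumberTheory.EllipticCurves Literature.NumberTheory.EllipticCurves.ModularForms
  Summit.BirchSwinnertonDyer.BirchSwinnertonDyer.Rank2Observatory.Tate
  Summit.BirchSwinnertonDyer.BirchSwinnertonDyer.Rank2Observatory.RootNumber

namespace Summit.BirchSwinnertonDyer.BirchSwinnertonDyer.Theorems.GoldfeldGoodTwists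

/-! ## §1 At `7`: type `III`, `ord₇ Δ_min = 3`, `c₇ = 2` -/

/-- The Step-2 certificate of `[0, 42, 0, 448, 0]` at `7` passes (`7 ∣ a₃, a₄, a₆, b₂`, `7³ ∥ Δ`, exit at
Step 4: `7² ∣ a₆ = 0`, `7² ∥ b₈ = −448²`). [cite: Silverman1994, IV.9.4 Steps 1–4] -/
theorem step2Cert_check_twoTorsionModel_two_seven :
    Step2Cert.check ⟨7, 0, 0, 0, 3, 3, 2⟩ ⟨0, 42, 0, 448, 0⟩ = true := by
  decide +kernel

/-- **`E₂ = [0, 42, 0, 448, 0]` has Kodaira type `III` and `ord Δ_min = 3` at the place above `7`.**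
[cite: Silverman1994, IV.9.4 Step 4] -/
theorem kodairaSymbolAt_twoTorsionModel_two_seven (v : HeightOneSpectrum (𝓞 ℚ)) (hv : natGenerator v = 7) :
    (⟨0, 42, 0, 448, 0⟩ : WeierstrassCurve ℚ).kodairaSymbolAt v = .III ∧
      (⟨0, 42, 0, 448, 0⟩ : WeierstrassCurve ℚ).ordMinimalDiscriminant v = 3 := by
  have h := Step2Cert.sound (W₀ := ⟨0, 42, 0, 448, 0⟩) (c := ⟨7, 0, 0, 0, 3, 3, 2⟩) v hv
    step2Cert_check_twoTorsionModel_two_seven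
  rw [← twoTorsionModel_two_eq_baseChange] at h
  exact h

/-- **`c₇(E₂) = 2`** (type `III`; tree `localTamagawaNumber_eq_two_of_kodairaSymbolAt_eq_III_holds`).
[cite: Silverman1994, IV.9.4 Step 4] -/
theorem localTamagawaNumber_twoTorsionModel_two_seven (v : HeightOneSpectrum (𝓞 ℚ)) (hv : natGenerator v = 7) :
    ((⟨0, 42, 0, 448, 0⟩ : WeierstrassCurve ℚ).baseChange (v.adicCompletion ℚ)).localTamagawaNumber
      (v.adicCompletionIntegers ℚ) = 2 := by
  haveI := isElliptic_twoTorsionModel_two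
  haveI := perfectField_residueField_adicCompletionIntegers (K := ℚ) v
  exact localTamagawaNumber_eq_two_of_kodairaSymbolAt_eq_III_holds v _
    (kodairaSymbolAt_twoTorsionModel_two_seven v hv).1

/-! ## §2 At `2`: type `I₈*`, `ord₂ Δ_min = 18`, `c₂ ∈ {2, 4}` -/

/-- `[0, 42, 0, 448, 0] = (1, 0, 0, 0) • [0, 42, 0, 448, 0]` (the model is already `2`-adically normalised). [folklore] -/
theorem model_twoTorsionModel_two_two :
    (⟨0, 42, 0, 448, 0⟩ : WeierstrassCurve ℤ) = (⟨1, 0, 0, 0⟩ : VariableChange ℤ) • ⟨0, 42, 0, 448, 0⟩ := by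
  rw [show (⟨1, 0, 0, 0⟩ : VariableChange ℤ) = 1 from rfl, one_smul]

/-- **`E₂` has Kodaira type `I₈*` and `ord Δ_min = 18` at the place above `2`** (the Rank2Observatory one-model `Iₙ*`
certificate, round `m = 3`, second test: `2 ∥ a₂`, `2⁶ ∣ a₄`, `(a₄/2⁶)² = 49` odd, `2¹⁸ ∥ Δ`). [cite: Silverman1994, IV.9.4 Step 7] -/
theorem kodairaSymbolAt_twoTorsionModel_two_two (v : HeightOneSpectrum (𝓞 ℚ)) (hv : natGenerator v = 2) :
    (⟨0, 42, 0, 448, 0⟩ : WeierstrassCurve ℚ).kodairaSymbolAt v = .Istar 8 ∧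
      (⟨0, 42, 0, 448, 0⟩ : WeierstrassCurve ℚ).ordMinimalDiscriminant v = 18 := by
  have hmin : ((⟨0, 42, 0, 448, 0⟩ : WeierstrassCurve ℤ).baseChange ℚ).IsMinimalAt v := by
    rw [← twoTorsionModel_two_eq_baseChange]
    exact isGloballyMinimal_twoTorsionModel_two.isMinimal v
  have h := kodairaSymbolAt_and_ordMinimalDiscriminant_of_intModel (v := v) hv ⟨0, 42, 0, 448, 0⟩
    ⟨0, 42, 0, 448, 0⟩ ⟨1, 0, 0, 0⟩ rfl model_twoTorsionModel_two_two hmin (n := 18) (by decide) (by decide)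
    (T := .Istar 8) (fun ε hε hpε =>
      kodairaSymbolOfMinimal_intCast_eq_Istar_even (m := 3) (n := 18) Nat.prime_two hε hpε
        (by decide) (by decide) (by decide) (by decide) (by decide) (by decide) (by decide)
        (by decide) (by decide) (by decide))
  rw [← twoTorsionModel_two_eq_baseChange] at h
  exact h

/-! ## §3 `c₂(E₂) = 4` EXACTLY: the full `2`-torsion of `J = E₂ ⊗ ℤ₂` over `ℚ₂` lies outside `J₀(ℚ₂)` -/

/-- **`−7` is a square in `ℤ₂`** (`−7 ≡ 1 (mod 8)`, the tree's Hensel step `padicInt_isSquare_of_toZModPow_three_eq_one`)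
— i.e. `2` splits in `ℚ(√−7)`, the standing hypothesis of the whole cell. [cite: Serre1973, Ch. II §3.3 Thm 4] -/
theorem exists_padicInt_two_sq_eq_neg_seven : ∃ s : ℤ_[2], s ^ 2 = -7 := by
  have h : IsSquare (-7 : ℤ_[2]) := by
    refine Literature.NumberTheory.QuadraticForms.padicInt_isSquare_of_toZModPow_three_eq_one (p := 2) ?_
    rw [map_neg, map_ofNat]
    decide
  obtain ⟨s, hs⟩ := h
  exact ⟨s, by rw [sq]; exact hs.symm⟩

/-- For a square root `s` of `−7` in `ℤ₂`: `s` is odd, so `s − 21 ∈ 𝔪` and `−s − 21 ∈ 𝔪`. [folklore] -/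
theorem sub_mem_maximalIdeal_of_sq_eq_neg_seven {s : ℤ_[2]} (hs : s ^ 2 = -7) :
    s - 21 ∈ maximalIdeal ℤ_[2] ∧ -s - 21 ∈ maximalIdeal ℤ_[2] := by
  have h : (PadicInt.toZMod s) ^ 2 = PadicInt.toZMod (-7 : ℤ_[2]) := by rw [← map_pow, hs]
  have h1 : PadicInt.toZMod s = 1 := by
    rw [map_neg, map_ofNat] at h
    revert h; generalize PadicInt.toZMod s = t; revert t; decide
  rw [← PadicInt.ker_toZMod, RingHom.mem_ker, RingHom.mem_ker, map_sub, map_sub, map_neg, h1, map_ofNat]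
  exact ⟨by decide, by decide⟩

/-- `J ⊗ ℚ₂` is elliptic, `J = [0, 42, 0, 448, 0]` over `ℤ₂` (`Δ = −2¹⁸·7³ ≠ 0`). [folklore] -/
theorem isElliptic_Jp3136 :
    ((⟨0, 42, 0, 448, 0⟩ : WeierstrassCurve ℤ_[2]).baseChange ℚ_[2]).IsElliptic := by
  refine ⟨isUnit_iff_ne_zero.mpr ?_⟩
  simp only [WeierstrassCurve.Δ, b₂, b₄, b₆, b₈, baseChange, map_a₁, map_a₂, map_a₃, map_a₄, map_a₆, map_ofNat, map_zero]
  norm_num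

/-- `T₀ = (0, 0) ∈ J(ℚ₂)` (the rational `2`-torsion point). [folklore] -/
theorem nonsingular_Jp3136_zero_zero :
    ((⟨0, 42, 0, 448, 0⟩ : WeierstrassCurve ℤ_[2]).baseChange ℚ_[2]).toAffine.Nonsingular
      (algebraMap ℤ_[2] ℚ_[2] 0) (algebraMap ℤ_[2] ℚ_[2] 0) := by
  rw [Affine.nonsingular_iff', Affine.equation_iff']
  simp only [baseChange, toAffine, map_a₁, map_a₂, map_a₃, map_a₄, map_a₆, map_ofNat, map_zero]
  norm_num

/-- `T₁ = (s − 21, 0) ∈ J(ℚ₂)` for `s² = −7` (`x² + 42x + 448 = (x + 21)² + 7` vanishes at `x = s − 21`). [folklore] -/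
theorem nonsingular_Jp3136_twoTorsion₁ {s : ℤ_[2]} (hs : s ^ 2 = -7) :
    ((⟨0, 42, 0, 448, 0⟩ : WeierstrassCurve ℤ_[2]).baseChange ℚ_[2]).toAffine.Nonsingular
      (algebraMap ℤ_[2] ℚ_[2] (s - 21)) (algebraMap ℤ_[2] ℚ_[2] 0) := by
  haveI := isElliptic_Jp3136
  refine (Affine.equation_iff_nonsingular).mp ?_
  have hs' : ((s : ℚ_[2])) ^ 2 = -7 := by exact_mod_cast congrArg ((↑) : ℤ_[2] → ℚ_[2]) hs
  rw [Affine.equation_iff']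
  simp only [baseChange, toAffine, map_a₁, map_a₂, map_a₃, map_a₄, map_a₆, map_ofNat, map_zero, map_sub,
    PadicInt.algebraMap_apply]
  linear_combination (21 - (s : ℚ_[2])) * hs'

/-- `T₂ = (−s − 21, 0) ∈ J(ℚ₂)` for `s² = −7`. [folklore] -/
theorem nonsingular_Jp3136_twoTorsion₂ {s : ℤ_[2]} (hs : s ^ 2 = -7) :
    ((⟨0, 42, 0, 448, 0⟩ : WeierstrassCurve ℤ_[2]).baseChange ℚ_[2]).toAffine.Nonsingular
      (algebraMap ℤ_[2] ℚ_[2] (-s - 21)) (algebraMap ℤ_[2] ℚ_[2] 0) :=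
  nonsingular_Jp3136_twoTorsion₁ (s := -s) (by rw [neg_sq]; exact hs)

/-- **`T₁ + T₀ = T₂` in `J(ℚ₂)`** (three collinear points on `y = 0`: slope `0`, `x₃ = −a₂ − x₁ − x₀`). [folklore] -/
theorem twoTorsion₁_add_zeroZero_Jp3136 {s : ℤ_[2]} (hs : s ^ 2 = -7) :
    (Affine.Point.some _ _ (nonsingular_Jp3136_twoTorsion₁ hs) :
        ((⟨0, 42, 0, 448, 0⟩ : WeierstrassCurve ℤ_[2]).baseChange ℚ_[2]).toAffine.Point) +
      Affine.Point.some _ _ nonsingular_Jp3136_zero_zero =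
      Affine.Point.some _ _ (nonsingular_Jp3136_twoTorsion₂ hs) := by
  have hs' : ((s : ℚ_[2])) ^ 2 = -7 := by exact_mod_cast congrArg ((↑) : ℤ_[2] → ℚ_[2]) hs
  have hx : algebraMap ℤ_[2] ℚ_[2] (s - 21) ≠ algebraMap ℤ_[2] ℚ_[2] 0 := by
    intro h0
    have h0' : (s : ℚ_[2]) - 21 = 0 := by simpa [map_sub, map_ofNat] using h0
    have h21 : (s : ℚ_[2]) = 21 := by linear_combination h0'
    rw [h21] at hs'
    norm_num at hs'
  rw [Affine.Point.add_of_X_ne hx]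
  refine point_some_congr ?_ ?_
  · rw [Affine.slope_of_X_ne hx]
    simp only [Affine.addX, baseChange, toAffine, map_a₁, map_a₂, map_ofNat, map_zero, map_sub, map_neg,
      PadicInt.algebraMap_apply]
    ring
  · rw [Affine.addY, Affine.negAddY, Affine.negY, Affine.slope_of_X_ne hx]
    simp only [Affine.addX, baseChange, toAffine, map_a₁, map_a₂, map_a₃, map_ofNat, map_zero, map_sub,
      PadicInt.algebraMap_apply]
    ring

/-- **`[J(ℚ₂) : J₀(ℚ₂)] = 4` for `J = [0, 42, 0, 448, 0]`** (an `Iₙ*` normal form: the index is `2` or `4` by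
`LocalIndex.index_mem_of_normalForm_Istar_succ`; the three `2`-torsion points `T₀ = (0,0)`, `T₁ = (s − 21, 0)`,
`T₂ = T₁ + T₀ = (−s − 21, 0)`, `s² = −7`, `s` odd, reduce to the singular point, so index `2` would put `T₀`, `T₁`,
`T₁ + T₀` in the same non-trivial coset). [cite: Silverman1994, IV.9.4 Step 7 and Table 4.1] -/
theorem index_nonsingularReductionSubgroup_Jp3136 :
    ((⟨0, 42, 0, 448, 0⟩ : WeierstrassCurve ℤ_[2]).nonsingularReductionSubgroup
      (integers_valuationRing_valuation ℤ_[2] ℚ_[2])).index = 4 := by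
  haveI : HenselianLocalRing ℤ_[2] :=
    { is_henselian := fun f hf a₀ h₁ h₂ =>
        HenselianRing.is_henselian (I := IsLocalRing.maximalIdeal ℤ_[2]) f hf a₀ h₁ (h₂.map _) }
  obtain ⟨s, hs⟩ := exists_padicInt_two_sq_eq_neg_seven
  set H := (⟨0, 42, 0, 448, 0⟩ : WeierstrassCurve ℤ_[2]).nonsingularReductionSubgroup
    (integers_valuationRing_valuation ℤ_[2] ℚ_[2]) with hH
  have hΔ : (⟨0, 42, 0, 448, 0⟩ : WeierstrassCurve ℤ_[2]).Δ ≠ 0 := by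
    simp only [WeierstrassCurve.Δ, b₂, b₄, b₆, b₈]; norm_num
  have h1 : (⟨0, 42, 0, 448, 0⟩ : WeierstrassCurve ℤ_[2]).a₁ ∈ maximalIdeal ℤ_[2] := by simp
  have h2 : (⟨0, 42, 0, 448, 0⟩ : WeierstrassCurve ℤ_[2]).a₂ ∈ maximalIdeal ℤ_[2] := by
    simpa using natCast_mem_maximalIdeal_padicInt_two (n := 42) (by norm_num)
  have h2' : (⟨0, 42, 0, 448, 0⟩ : WeierstrassCurve ℤ_[2]).a₂ ∉ maximalIdeal ℤ_[2] ^ 2 := by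
    have h := (intCast_mem_maximalIdeal_pow_padicInt_two_iff 42 2).not.mpr (by norm_num)
    simpa using h
  have h3 : (⟨0, 42, 0, 448, 0⟩ : WeierstrassCurve ℤ_[2]).a₃ ∈ maximalIdeal ℤ_[2] ^ 2 := by simp
  have h4 : (⟨0, 42, 0, 448, 0⟩ : WeierstrassCurve ℤ_[2]).a₄ ∈ maximalIdeal ℤ_[2] ^ 3 := by
    have h := (intCast_mem_maximalIdeal_pow_padicInt_two_iff 448 3).mpr (by norm_num)
    simpa using h
  have h6 : (⟨0, 42, 0, 448, 0⟩ : WeierstrassCurve ℤ_[2]).a₆ ∈ maximalIdeal ℤ_[2] ^ 4 := by simp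
  rcases LocalIndex.index_mem_of_normalForm_Istar_succ (K := ℚ_[2]) _ hΔ h1 h2 h2' h3 h4 h6 with h | h
  swap
  · exact h
  exfalso
  -- the three bad points
  have h3₁ : (⟨0, 42, 0, 448, 0⟩ : WeierstrassCurve ℤ_[2]).a₃ ∈ maximalIdeal ℤ_[2] := by simp
  have h4₁ : (⟨0, 42, 0, 448, 0⟩ : WeierstrassCurve ℤ_[2]).a₄ ∈ maximalIdeal ℤ_[2] := by
    simpa using natCast_mem_maximalIdeal_padicInt_two (n := 448) (by norm_num)
  have h0 : (0 : ℤ_[2]) ∈ maximalIdeal ℤ_[2] := Ideal.zero_mem _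
  obtain ⟨hx₁, hx₂⟩ := sub_mem_maximalIdeal_of_sq_eq_neg_seven hs
  have hT : (Affine.Point.some _ _ nonsingular_Jp3136_zero_zero) ∉ H := fun hmem =>
    LocalIndex.not_hasNonsingularReduction_some _ h3₁ h4₁ h0 h0 nonsingular_Jp3136_zero_zero
      ((mem_nonsingularReductionSubgroup_iff _).mp hmem)
  have hP : (Affine.Point.some _ _ (nonsingular_Jp3136_twoTorsion₁ hs)) ∉ H := fun hmem =>
    LocalIndex.not_hasNonsingularReduction_some _ h3₁ h4₁ hx₁ h0 (nonsingular_Jp3136_twoTorsion₁ hs)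
      ((mem_nonsingularReductionSubgroup_iff _).mp hmem)
  have hPT : (Affine.Point.some _ _ (nonsingular_Jp3136_twoTorsion₂ hs)) ∉ H := fun hmem =>
    LocalIndex.not_hasNonsingularReduction_some _ h3₁ h4₁ hx₂ h0 (nonsingular_Jp3136_twoTorsion₂ hs)
      ((mem_nonsingularReductionSubgroup_iff _).mp hmem)
  -- index two: one non-trivial coset `· + a`
  obtain ⟨a, ha⟩ := AddSubgroup.index_eq_two_iff.mp h
  have key : ∀ P, P ∉ H → P + a ∈ H := fun P hP => by
    rcases ha P with ⟨h', -⟩ | ⟨h', -⟩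
    · exact h'
    · exact (hP h').elim
  have ha' : a ∈ H := by
    have e : a = (Affine.Point.some _ _ (nonsingular_Jp3136_twoTorsion₁ hs) + a) +
        (Affine.Point.some _ _ nonsingular_Jp3136_zero_zero + a) -
        (Affine.Point.some _ _ (nonsingular_Jp3136_twoTorsion₂ hs) + a) := by
      rw [← twoTorsion₁_add_zeroZero_Jp3136 hs]; abel
    rw [e]
    exact H.sub_mem (H.add_mem (key _ hP) (key _ hT)) (key _ hPT)
  rcases ha 0 with ⟨-, h'⟩ | ⟨-, h'⟩
  · exact h' H.zero_mem
  · exact h' (by rwa [zero_add])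

/-- `E₂ ⊗ ℚ₂ = J ⊗ ℚ₂` along the identity change, `J = [0, 42, 0, 448, 0]` over `ℤ₂`. [folklore] -/
theorem smul_twoTorsionModel_two_padic_two :
    (1 : VariableChange ℚ_[2]) • ((⟨0, 42, 0, 448, 0⟩ : WeierstrassCurve ℚ).baseChange ℚ_[2]) =
      (⟨0, 42, 0, 448, 0⟩ : WeierstrassCurve ℤ_[2]).baseChange ℚ_[2] := by
  rw [one_smul]
  ext <;> simp only [baseChange, map_a₁, map_a₂, map_a₃, map_a₄, map_a₆, map_ofNat, map_zero]

/-- `J ⊗ ℚ₂` is a MINIMAL equation over `ℤ₂` (file III's Kraus test at `2`, on Mathlib's `ℚ₂`). [cite: Kraus1989, Thm 2 (p = 2)] -/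
theorem isMinimal_Jp3136_padic_two :
    ((⟨0, 42, 0, 448, 0⟩ : WeierstrassCurve ℤ_[2]).baseChange ℚ_[2]).IsMinimal ℤ_[2] := by
  set w₂ : HeightOneSpectrum (𝓞 ℚ) := (primesEquiv (R := 𝓞 ℚ)).symm ⟨2, Nat.prime_two⟩ with hw₂
  have h2 : ((primesEquiv w₂ : Nat.Primes) : ℕ) = 2 := by rw [hw₂, Equiv.apply_symm_apply]
  have hmin : ((⟨0, 42, 0, 448, 0⟩ : WeierstrassCurve ℤ).baseChange ℚ).IsMinimalAt w₂ := by
    rw [← twoTorsionModel_two_eq_baseChange]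
    exact isGloballyMinimal_twoTorsionModel_two.isMinimal w₂
  have hmin2 := (isMinimalAt_iff_isMinimal_padic w₂ 2 h2 _).mp hmin
  have e : ((⟨0, 42, 0, 448, 0⟩ : WeierstrassCurve ℤ).baseChange ℚ).baseChange ℚ_[2] =
      (⟨0, 42, 0, 448, 0⟩ : WeierstrassCurve ℤ_[2]).baseChange ℚ_[2] := by
    ext <;> simp only [baseChange, map_a₁, map_a₂, map_a₃, map_a₄, map_a₆, map_ofNat, map_zero]
  rw [← e]
  exact hmin2

/-- **`c₂(E₂) = 4`** (Mathlib's `2`-adic numbers): the local Tamagawa number of `E₂ ⊗ ℚ₂` is the index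
`[J(ℚ₂) : J₀(ℚ₂)] = 4`. [cite: Silverman1994, IV.9.4 Step 7 and Table 4.1] [cite: CremonaAlgorithms1997, Table 1 (N = 3136)] -/
theorem localTamagawaNumber_padic_twoTorsionModel_two_two :
    (haveI := isElliptic_twoTorsionModel_two
     ((⟨0, 42, 0, 448, 0⟩ : WeierstrassCurve ℚ).baseChange ℚ_[2]).localTamagawaNumber ℤ_[2]) = 4 := by
  haveI := isElliptic_twoTorsionModel_two
  haveI := isMinimal_Jp3136_padic_two
  rw [LocalIndex.localTamagawaNumber_eq_index_of_smul_eq_baseChange _ _ _ smul_twoTorsionModel_two_padic_two]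
  exact index_nonsingularReductionSubgroup_Jp3136

/-- **`c₂(E₂) = 4` at the place of `𝓞 ℚ` above `2`** (bridged by `localTamagawaNumber_padic_eq_holds`).
[cite: Silverman1994, IV.9.4 Step 7 and Table 4.1] -/
theorem localTamagawaNumber_twoTorsionModel_two_two_eq_four (w : HeightOneSpectrum (𝓞 ℚ))
    (hw : natGenerator w = 2) :
    (haveI := isElliptic_twoTorsionModel_two
     ((⟨0, 42, 0, 448, 0⟩ : WeierstrassCurve ℚ).baseChange (w.adicCompletion ℚ)).localTamagawaNumber
        (w.adicCompletionIntegers ℚ)) = 4 := by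
  haveI := isElliptic_twoTorsionModel_two
  rw [← localTamagawaNumber_padic_eq_holds (⟨0, 42, 0, 448, 0⟩ : WeierstrassCurve ℚ) w 2 hw]
  exact localTamagawaNumber_padic_twoTorsionModel_two_two

/-! ## §4 `Tam(E₂) = 8` -/

/-- `Δ([0, 42, 0, 448, 0]) = −2¹⁸·7³ = Δ([0, −42, 0, 448, 0])`: a prime dividing it is `2` or `7`. [folklore] -/
theorem eq_two_or_seven_of_dvd_Δ_twoTorsionModel_two {p : ℕ} (hp : p.Prime)
    (h : (p : ℤ) ∣ (⟨0, 42, 0, 448, 0⟩ : WeierstrassCurve ℤ).Δ) : p = 2 ∨ p = 7 := by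
  rw [invariants_twoTorsionModel_two.2.2, ← invariants_twoTorsionModel_neg_two.2.2] at h
  exact eq_two_or_seven_of_dvd_Δ_W3136 hp h

/-- **`Tam(E₂) = c₂ · c₇ = 4 · 2 = 8` IN THE KERNEL** (bad places `2, 7` of `Δ = −2¹⁸·7³`; product formula
`tamagawaProduct_eq_prod`). [cite: Silverman1994, IV.9.4 and Table 4.1] [cite: CremonaAlgorithms1997, Table 1 (N = 3136)] -/
theorem tamagawaProduct_twoTorsionModel_two : (⟨0, 42, 0, 448, 0⟩ : WeierstrassCurve ℚ).tamagawaProduct = 8 := by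
  haveI := isElliptic_twoTorsionModel_two
  set v₂ : HeightOneSpectrum ℤ := (primesEquiv (R := ℤ)).symm ⟨2, Nat.prime_two⟩ with hv₂
  set v₇ : HeightOneSpectrum ℤ := (primesEquiv (R := ℤ)).symm ⟨7, by norm_num⟩ with hv₇
  have h2 : (primesEquiv v₂ : ℕ) = 2 := by rw [hv₂, Equiv.apply_symm_apply]
  have h7 : (primesEquiv v₇ : ℕ) = 7 := by rw [hv₇, Equiv.apply_symm_apply]
  have hne : v₂ ≠ v₇ := by
    intro h; have := congrArg (fun v => (primesEquiv v : ℕ)) h; simp only [h2, h7] at this; omega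
  have hprod := tamagawaProduct_eq_prod (⟨0, 42, 0, 448, 0⟩ : WeierstrassCurve ℚ) {v₂, v₇} (by
    intro v hv
    by_contra hmem
    apply hv
    rw [twoTorsionModel_two_eq_baseChange]
    refine hasGoodReductionAt_of_not_dvd fun hdvd => hmem ?_
    rcases eq_two_or_seven_of_dvd_Δ_twoTorsionModel_two (prime_natGenerator v) hdvd with h | h
    · have : v = v₂ := by
        apply (primesEquiv (R := ℤ)).injective
        exact Subtype.ext (by rw [h2]; exact h)
      simp [this]
    · have : v = v₇ := by
        apply (primesEquiv (R := ℤ)).injective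
        exact Subtype.ext (by rw [h7]; exact h)
      simp [this])
  rw [Finset.prod_pair hne] at hprod
  haveI : Fact (Nat.Prime 2) := ⟨Nat.prime_two⟩
  haveI : Fact (Nat.Prime 7) := ⟨by norm_num⟩
  have c7 := localTamagawaNumber_padic_eq_of_forall_place (⟨0, 42, 0, 448, 0⟩ : WeierstrassCurve ℚ) v₇ 7 h7 2
    (fun w hw => localTamagawaNumber_twoTorsionModel_two_seven w hw)
  have c2 := localTamagawaNumber_padic_eq_of_forall_place (⟨0, 42, 0, 448, 0⟩ : WeierstrassCurve ℚ) v₂ 2 h2 4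
    (fun w hw => localTamagawaNumber_twoTorsionModel_two_two_eq_four w hw)
  rw [hprod, c2, c7]
  norm_num

/-! ## §5 The period law of the genus pair `(8, −ℓ)`: `Ω(E₂) · √8 = Ω(X₀(49))` -/

/-- **THE PERIOD LAW `Ω(E₂) · √8 = Ω(X₀(49))`** — Pal 2012 Thm 3.2 for `d = 2 > 0` on `E₂ = (1/2, 4, 0, 0) • cm7^{(2)}`
gives `Ω(E₂)·√2 = ½·Ω(cm7)` (`Ω = realPeriodRat`, all real components), i.e. Pal's `ũ = 1` for the twist of `X₀(49)` by the
fundamental discriminant `8` (`√8 = 2√2`). Numerically `0.6835289 · 2.8284271 = 1.9333058 = Ω(49a1)`.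
[cite: Pal2012, Thm. 3.2 (case d > 0)] -/
theorem realPeriodRat_twoTorsionModel_two_mul_sqrt_eight :
    (⟨0, 42, 0, 448, 0⟩ : WeierstrassCurve ℚ).realPeriodRat * Real.sqrt 8 = cm7.realPeriodRat := by
  have h := cm7.realPeriodRat_mul_sqrt_of_twist_of_pos (d := 2) (by norm_num) _ _
    twoTorsionChange_smul_cm7_quadraticTwist_two_rat
  have hu : |((((⟨(Units.mk0 (2 : ℚ) two_ne_zero)⁻¹, 4, 0, 0⟩ : VariableChange ℚ).u : ℚ) : ℝ))| = 1 / 2 := by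
    rw [Units.val_inv_eq_inv_val, Units.val_mk0]; push_cast; norm_num
  have h8 : Real.sqrt 8 = 2 * Real.sqrt ((2 : ℚ) : ℝ) := by
    rw [show ((2 : ℚ) : ℝ) = 2 by norm_num, show (8 : ℝ) = 2 ^ 2 * 2 by norm_num, Real.sqrt_mul (by norm_num),
      Real.sqrt_sq (by norm_num)]
  rw [hu] at h
  rw [h8, ← mul_assoc, mul_comm _ (2 : ℝ), mul_assoc, h]
  ring

/-! ## §6 «BSD(3136⁺) exact» by name: `L(E₂, 1) = r · Ω(E₂)`, `v₂(r) = 1` -/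

/-- **«BSD(3136⁺) EXACT» BY NAME**: granted bsd.S31 (`bsdTriple_of_rank_le_one_of_conductor_lt`) and Modularity
(`exists_isNewformOf`) ONLY, `L(E₂, 1)` (`= entireLFunction 1`, the leading coefficient in analytic rank `0`) is `r · Ω(E₂)`,
`r ∈ ℚ_{>0}`, `v₂(r) = 1` (`r = #Ш · Reg · Tam / #tors² = #Ш · 1 · 8 / 4`, `#Ш` odd: files IV/V, §4, `N = 3136 < 5000`).
[cite: CreutzMiller2012, Thm 1.1 and the remark following it] [cite: CremonaAlgorithms1997, Table 1 (N = 3136)] -/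
theorem lValue_twoTorsionModel_two (hS31 : bsdTriple_of_rank_le_one_of_conductor_lt) (hmod : exists_isNewformOf) :
    ∃ r : ℚ, padicValRat 2 r = 1 ∧ 0 < r ∧
      (⟨0, 42, 0, 448, 0⟩ : WeierstrassCurve ℚ).entireLFunction 1 =
        ((r : ℝ) * (⟨0, 42, 0, 448, 0⟩ : WeierstrassCurve ℚ).realPeriodRat : ℝ) := by
  haveI := isElliptic_twoTorsionModel_two
  obtain ⟨hr0, -, hodd, hlead⟩ := analyticRank_shaFinite_odd_twoTorsionModel_two hS31 hmod
  have hrank := rank_eq_zero_and_sha_two_twoTorsionModel_two.1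
  have htors := torsion_twoTorsionModel_two.2
  have hreg : (⟨0, 42, 0, 448, 0⟩ : WeierstrassCurve ℚ).regulator = 1 := regulator_eq_one_of_rank_zero _ hrank
  set S := (⟨0, 42, 0, 448, 0⟩ : WeierstrassCurve ℚ).shaOrder with hS
  refine ⟨2 * (S : ℚ), ?_, ?_, ?_⟩
  · have hS0 : (S : ℚ) ≠ 0 := by exact_mod_cast hodd.pos.ne'
    haveI : Fact (Nat.Prime 2) := ⟨Nat.prime_two⟩
    have h22 : padicValRat 2 (2 : ℚ) = 1 := by simpa using padicValRat.self (p := 2) one_lt_two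
    have h1 : padicValNat 2 S = 0 := padicValNat.eq_zero_of_not_dvd (fun h =>
      (Nat.not_even_iff_odd.mpr hodd) (even_iff_two_dvd.mpr h))
    rw [padicValRat.mul two_ne_zero hS0, h22, padicValRat.of_nat, h1]
    norm_num
  · exact mul_pos two_pos (by exact_mod_cast hodd.pos)
  · have hreal : (⟨0, 42, 0, 448, 0⟩ : WeierstrassCurve ℚ).bsdRHS =
        ((2 * (S : ℚ) : ℚ) : ℝ) * (⟨0, 42, 0, 448, 0⟩ : WeierstrassCurve ℚ).realPeriodRat := by
      rw [bsdRHS_def, tamagawaProduct_twoTorsionModel_two, htors, hreg]; push_cast; ring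
    rw [← leadingLCoeff_eq_of_analyticRank_eq_zero _ hr0, hlead, hreal]

/-- **The F3 input in the memo's form: `L(E₂, 1) · √8 = r · Ω(X₀(49))`, `v₂(r) = 1`, `r > 0`** (§6 with the period
law §5) — so `√8 · L(49a1^{(2)}, 1) / L(49a1, 1) = r / (L(49a1,1)/Ω(49a1))` has `2`-adic valuation `1 − (−1) = 2` once
`L(49a1,1)/Ω(49a1) = ½·#Ш(49a1)` (CLTZ Thm 1.2 at `R = 1`) is fed in by the consumer.
[cite: CreutzMiller2012, Thm 1.1 and the remark following it] [cite: Pal2012, Thm. 3.2 (case d > 0)] -/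
theorem lValue_twoTorsionModel_two_mul_sqrt_eight (hS31 : bsdTriple_of_rank_le_one_of_conductor_lt)
    (hmod : exists_isNewformOf) :
    ∃ r : ℚ, padicValRat 2 r = 1 ∧ 0 < r ∧
      (⟨0, 42, 0, 448, 0⟩ : WeierstrassCurve ℚ).entireLFunction 1 * (Real.sqrt 8 : ℂ) =
        ((r : ℝ) * cm7.realPeriodRat : ℝ) := by
  obtain ⟨r, hr, hr0, hL⟩ := lValue_twoTorsionModel_two hS31 hmod
  refine ⟨r, hr, hr0, ?_⟩
  rw [hL, ← realPeriodRat_twoTorsionModel_two_mul_sqrt_eight]; push_cast; ring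

end Summit.BirchSwinnertonDyer.BirchSwinnertonDyer.Theorems.GoldfeldGoodTwists

end
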